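import Summits.CriticalPhenomena.PercolationContinuityZ3.Theorems.PercNearOneGluingNoHeavyQuantGateMoveBlobCol
import HarnessLib

/-!
# QUANT lane R8, T-DEC, leg (III): the PARTIAL FLOW of the blob gate move (part 2b of 3)

builds on p205010 (kernel theorem, internal audit signed; external expert review pending)

Support file (`--supports stmt-CriticalPhenomena-4575`), QUANT lane typer seat prim-quant-stmt (gen 27), rung R8 of
`run/shared/lean/prim/quant/LADDER.md`.  One theorem, standard axioms, no sorries, no definitions.  Parts 1, 2a: `…QuantGateMoveBlobRates`, `…QuantGateMoveBlobCol`.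

SETTING.  `0 < y < 1`, `0 ≤ z`, `g ≤ 1`, `y ≤ (1−z)g`, `1 ≤ a`; `ν ≥ 0` a probability law on `{0..M}` with mean `S`, `z ≤ ν 0`, and NO
UNSHIFTED ATOM STRICTLY BETWEEN `0` AND `a` (`(1−g)·ν k = 0` for `0 < k < a` — automatic for `a = 1` and for `g = 1`).
`Λ = slice ν a g` (target `τ = S + ag`), `P = Λ + gz(δ₀ − δ_a)` (target `t = τ − zag`), layer `j` with `a ≤ j < M + a` and `2a < t`
(the atom `a` is a low of `P`); `f` a flow witness of `Λ` at `(y, τ, j)`.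
THE PARTIAL FLOW `φ` of the NONZERO lows of `P` into MIDS (`LawDec.gateMoveBlob_partial`): (i) every nonzero low keeps its `f`-pairs into
mids (cheaper at the smaller target), the atom `a` keeping only the fraction `κ` of them that its reduced mass `Λ a − gz` still needs after
its giant-bound mass has been cut first; (ii) the giant-bound masses (that of `a` reduced by the cut) are poured, proportionally, into the
SLOTS: the mid pairs of the atom `0` (all of them — the zero atom is re-routed by part 3) and the vacated fraction `1 − κ` of the mid pairs of
`a`; a nonzero low `l ≥ a` pays there at most what `0` resp. `a` paid (`rho_le_rho_zero`, `rho_le_rho_of_le_low`).  CONCLUSIONS: `φ ≥ 0`;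
its pairs are (nonzero `t`-low, `t`-compatible mid `m ≤ j` with `2m > τ`); every column of `φ` is loaded at most as the same column of `f`;
every nonzero low ships at most its `P`-mass; and the DICHOTOMY — either every nonzero low is fully placed (slots not full), or (slots full)
`y/(1−y)·(P 0 + unplaced) ≤ Σ_{giants} P` (the giant room certified by `f`).  Part 3 finishes with the first-moment criterion resp.
criterion E on the remainder.

[this work]; the template is typer g26's `…QuantGatedShiftPartial` (Conjecture R); flow normal form: typer g22 / lead g21 (this lane).
The gluing rows served [cite: KozmaNitzan2024, Conjecture 3 (p. 15)]; product measure [cite: Grimmett1999, §1.3 p. 10].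
-/

noncomputable section

namespace Summit.CriticalPhenomena.PercolationContinuityZ3.Theorems

namespace Quant

open Finset

namespace LawDec

/-- **THE PARTIAL FLOW OF THE BLOB GATE MOVE.**  See the file header. [this work] -/
theorem gateMoveBlob_partial (y z g τ t : ℝ) (a j M : ℕ) (ν : ℕ → ℝ) (f : ℕ → ℕ → ℝ)
    (hy0 : 0 < y) (hy1 : y < 1) (hz0 : 0 ≤ z) (hg1 : g ≤ 1) (hyg : y ≤ (1 - z) * g) (ha : 1 ≤ a)
    (hν0 : ∀ h, 0 ≤ ν h) (hν1 : ∑ h ∈ Finset.range (M + 1), ν h = 1) (hzν : z ≤ ν 0)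
    (hsupp : ∀ k, 0 < k → k < a → (1 - g) * ν k = 0)
    (ht : t = τ - z * (a : ℝ) * g)
    (hjN : j < M + a) (haj : a ≤ j) (hat : 2 * (a : ℝ) < t)
    (hf : IsFlowAtT y τ j (M + a) (slice ν a g) f) :
    ∃ φ : ℕ → ℕ → ℝ,
      (∀ l m, 0 ≤ φ l m) ∧
      (∀ l m, 0 < φ l m → l ≤ j ∧ 2 * (l : ℝ) < t ∧ m ≤ M + a ∧ (j + 1 ≤ m ∨ t < (l : ℝ) + m)) ∧
      (∀ l m, 0 < φ l m → 1 ≤ l ∧ m ≤ j ∧ τ < 2 * (m : ℝ)) ∧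
      (∀ h, h ≤ j → ∑ l ∈ Finset.range (j + 1), usage y t j l h * φ l h
        ≤ ∑ l ∈ Finset.range (j + 1), usage y τ j l h * f l h) ∧
      (∀ l : ℕ, 1 ≤ l → l ≤ j → 2 * (l : ℝ) < t → ∑ m ∈ Finset.range (M + a + 1), φ l m
        ≤ slice ν a g l + g * z * ((if l = 0 then (1 : ℝ) else 0) - (if l = a then (1 : ℝ) else 0))) ∧
      ((∀ l : ℕ, 1 ≤ l → l ≤ j → 2 * (l : ℝ) < t → ∑ m ∈ Finset.range (M + a + 1), φ l m
          = slice ν a g l + g * z * ((if l = 0 then (1 : ℝ) else 0) - (if l = a then (1 : ℝ) else 0))) ∨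
       (y / (1 - y) * ((slice ν a g 0 + g * z) + ∑ l ∈ Finset.range (j + 1),
          (if (1 ≤ l ∧ 2 * (l : ℝ) < t) then
            (slice ν a g l + g * z * ((if l = 0 then (1 : ℝ) else 0) - (if l = a then (1 : ℝ) else 0))
              - ∑ m ∈ Finset.range (M + a + 1), φ l m) else 0))
          ≤ ∑ h ∈ Finset.Ico (j + 1) (M + a + 1), slice ν a g h)) := by
  obtain ⟨hf0, hfsupp, hfrow, hfcap⟩ := hf
  -- scalars
  have hz1 : z ≤ 1 := by
    have h0 := Finset.single_le_sum (fun h _ => hν0 h) (Finset.mem_range.2 (Nat.succ_pos M))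
    rw [hν1] at h0
    exact hzν.trans h0
  have hg0 : 0 < g := by
    by_contra hc
    have : (1 - z) * g ≤ 0 := mul_nonpos_of_nonneg_of_nonpos (by linarith) (not_lt.1 hc)
    linarith
  have ha0 : (0 : ℝ) < a := by exact_mod_cast ha
  have hgz0 : 0 ≤ g * z := mul_nonneg hg0.le hz0
  have hzag : 0 ≤ z * (a : ℝ) * g := mul_nonneg (mul_nonneg hz0 ha0.le) hg0.le
  have htτ : t ≤ τ := by rw [ht]; linarith
  have hτ2a : 2 * (a : ℝ) < τ := lt_of_lt_of_le hat htτ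
  have ha0' : a ≠ 0 := by omega
  have hjN1 : j + 1 ≤ M + a + 1 := by omega
  -- a charged pair of `f` into a column `h ≤ j` is a compatible mid pair
  have hfmid : ∀ l h : ℕ, h ≤ j → 0 < f l h → τ < (l : ℝ) + h ∧ 2 * (l : ℝ) < τ ∧ l < h := by
    intro l h hhj hp
    obtain ⟨_, h2, _, hc⟩ := hfsupp l h hp
    have hc' : τ < (l : ℝ) + h := hc.resolve_left (by omega)
    refine ⟨hc', h2, ?_⟩
    have : (l : ℝ) < h := by linarith
    exact_mod_cast this
  -- below the blob there is no unshifted mass, hence no flow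
  have hΛlt : ∀ l : ℕ, 0 < l → l < a → slice ν a g l = 0 := by
    intro l hl hla
    rw [slice_apply_of_lt ν a g l hla, hsupp l hl hla]
  have fzero_below : ∀ l : ℕ, 0 < l → l < a → ∀ h, f l h = 0 := by
    intro l hl hla h
    by_contra hne
    have hp : 0 < f l h := lt_of_le_of_ne (hf0 l h) (Ne.symm hne)
    obtain ⟨h1, h2, hh, _⟩ := hfsupp l h hp
    have hr := hfrow l h1 h2
    rw [hΛlt l hl hla] at hr
    have := Finset.single_le_sum (fun h' _ => hf0 l h') (Finset.mem_range.2 (Nat.lt_succ_of_le hh))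
    rw [hr] at this
    linarith
  -- row pieces: flow into mids and into giants
  obtain ⟨Fm, hFm⟩ : ∃ Fm : ℕ → ℝ, ∀ l, Fm l = ∑ m ∈ Finset.range (j + 1), f l m := ⟨_, fun l => rfl⟩
  obtain ⟨Gn, hGn⟩ : ∃ Gn : ℕ → ℝ, ∀ l, Gn l = ∑ h ∈ Finset.Ico (j + 1) (M + a + 1), f l h := ⟨_, fun l => rfl⟩
  have hFm0 : ∀ l, 0 ≤ Fm l := fun l => by rw [hFm]; exact Finset.sum_nonneg fun m _ => hf0 l m
  have hGn0 : ∀ l, 0 ≤ Gn l := fun l => by rw [hGn]; exact Finset.sum_nonneg fun m _ => hf0 l m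
  have hrow : ∀ l : ℕ, l ≤ j → 2 * (l : ℝ) < τ → Fm l + Gn l = slice ν a g l := by
    intro l hl hl2
    rw [← hfrow l hl hl2, hFm, hGn, Finset.sum_range_add_sum_Ico _ hjN1]
  -- the atom `a`: cut its giant-bound mass first, then the fraction `1 − κ` of its mid pairs
  have hΛa : slice ν a g a = (1 - g) * ν a + g * ν 0 := slice_apply_self ν a g
  have hgzΛa : g * z ≤ slice ν a g a := by
    rw [hΛa]; nlinarith [hν0 a, mul_le_mul_of_nonneg_left hzν hg0.le]
  have hrowa : Fm a + Gn a = slice ν a g a := hrow a haj hτ2a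
  obtain ⟨vG, hvG⟩ : ∃ vG : ℝ, vG = min (g * z) (Gn a) := ⟨_, rfl⟩
  obtain ⟨vM, hvM⟩ : ∃ vM : ℝ, vM = g * z - vG := ⟨_, rfl⟩
  have hvG0 : 0 ≤ vG := by rw [hvG]; exact le_min hgz0 (hGn0 a)
  have hvGG : vG ≤ Gn a := by rw [hvG]; exact min_le_right _ _
  have hvM0 : 0 ≤ vM := by rw [hvM, hvG]; linarith [min_le_left (g * z) (Gn a)]
  have hvMF : vM ≤ Fm a := by
    rw [hvM, hvG]
    rcases le_total (g * z) (Gn a) with hc | hc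
    · rw [min_eq_left hc]; linarith [hFm0 a]
    · rw [min_eq_right hc]; linarith
  have hgzsplit : g * z = vG + vM := by rw [hvM]; ring
  obtain ⟨κ, hκ⟩ : ∃ κ : ℝ, κ = 1 - vM / Fm a := ⟨_, rfl⟩
  have hκ1 : κ ≤ 1 := by rw [hκ]; linarith [div_nonneg hvM0 (hFm0 a)]
  have hκ0 : 0 ≤ κ := by
    rw [hκ]
    rcases (hFm0 a).eq_or_lt with h0 | hpos
    · rw [← h0, div_zero]; norm_num
    · rw [sub_nonneg, div_le_one hpos]; exact hvMF
  have hκF : κ * Fm a = Fm a - vM := by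
    rw [hκ]
    rcases (hFm0 a).eq_or_lt with h0 | hpos
    · have : vM = 0 := le_antisymm (by rw [h0]; exact hvMF) hvM0
      rw [← h0, this]; ring
    · field_simp
  -- the slots: the mid pairs of `0` and the vacated fraction of the mid pairs of `a`
  obtain ⟨w, hw⟩ : ∃ w : ℕ → ℝ, ∀ m, w m = f 0 m + (1 - κ) * f a m := ⟨_, fun m => rfl⟩
  obtain ⟨W, hW⟩ : ∃ W : ℝ, W = Fm 0 + vM := ⟨_, rfl⟩
  have hw0 : ∀ m, 0 ≤ w m := fun m => by rw [hw]; exact add_nonneg (hf0 0 m) (mul_nonneg (by linarith) (hf0 a m))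
  have hW0 : 0 ≤ W := by rw [hW]; exact add_nonneg (hFm0 0) hvM0
  have hwsum : ∑ m ∈ Finset.range (j + 1), w m = W := by
    rw [Finset.sum_congr rfl fun m _ => hw m, Finset.sum_add_distrib, ← Finset.mul_sum, ← hFm, ← hFm, hW]
    linear_combination (-1 : ℝ) * hκF
  -- unplaced (giant-bound) masses of the nonzero lows, and the dichotomy parameter
  obtain ⟨R, hR⟩ : ∃ R : ℕ → ℝ, ∀ l, R l = if l = a then Gn a - vG else Gn l := ⟨_, fun l => rfl⟩
  have hR0 : ∀ l, 0 ≤ R l := by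
    intro l; rw [hR]; split_ifs
    · linarith
    · exact hGn0 l
  have hRlt : ∀ l : ℕ, 0 < l → l < a → R l = 0 := by
    intro l hl hla
    rw [hR, if_neg (Nat.ne_of_lt hla), hGn]
    exact Finset.sum_eq_zero fun h _ => fzero_below l hl hla h
  have hRge : ∀ l : ℕ, 1 ≤ l → 0 < R l → a ≤ l := by
    intro l hl hRl
    by_contra hc
    exact absurd (hRlt l hl (not_le.1 hc)) (ne_of_gt hRl)
  obtain ⟨Rtot, hRtot⟩ : ∃ Rtot : ℝ,
      Rtot = ∑ l ∈ Finset.range (j + 1), (if (1 ≤ l ∧ 2 * (l : ℝ) < t) then R l else 0) := ⟨_, rfl⟩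
  have hRtot0 : 0 ≤ Rtot := by
    rw [hRtot]; exact Finset.sum_nonneg fun l _ => by split_ifs; exacts [hR0 l, le_rfl]
  have hRle : ∀ l : ℕ, 1 ≤ l → l ≤ j → 2 * (l : ℝ) < t → R l ≤ Rtot := by
    intro l hl1 hlj hl2
    have := Finset.single_le_sum (f := fun l : ℕ => if (1 ≤ l ∧ 2 * (l : ℝ) < t) then R l else 0)
      (fun l _ => by split_ifs; exacts [hR0 l, le_rfl]) (Finset.mem_range.2 (Nat.lt_succ_of_le hlj))
    rw [← hRtot] at this
    simpa only [if_pos (And.intro hl1 hl2)] using this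
  obtain ⟨π, hπ⟩ : ∃ π : ℝ, π = if Rtot ≤ W then 1 else W / Rtot := ⟨_, rfl⟩
  have hπ0 : 0 ≤ π := by rw [hπ]; split_ifs; exacts [zero_le_one, div_nonneg hW0 hRtot0]
  have hπ1 : π ≤ 1 := by
    rw [hπ]; split_ifs with hc
    · exact le_rfl
    · rw [div_le_one (lt_of_le_of_lt hW0 (not_le.1 hc))]; exact (not_le.1 hc).le
  have hπR : π * Rtot ≤ W := by
    rw [hπ]; split_ifs with hc
    · rwa [one_mul]
    · rw [div_mul_cancel₀ _ (ne_of_gt (lt_of_le_of_lt hW0 (not_le.1 hc)))]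
  have hRπ : ∀ l : ℕ, 1 ≤ l → l ≤ j → 2 * (l : ℝ) < t → W = 0 → R l * π = 0 := by
    intro l hl1 hlj hl2 hW0'
    rw [hπ]; split_ifs with hc
    · have : R l ≤ 0 := (hRle l hl1 hlj hl2).trans (hc.trans hW0'.le)
      rw [le_antisymm this (hR0 l)]; ring
    · rw [hW0']; ring
  -- the partial flow: kept mid pairs plus proportional slot fills
  obtain ⟨kept, hkept⟩ : ∃ kept : ℕ → ℕ → ℝ, ∀ l m, kept l m = if l = a then κ * f a m else f l m :=
    ⟨_, fun l m => rfl⟩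
  have hkept0 : ∀ l m, 0 ≤ kept l m := by
    intro l m; rw [hkept]; split_ifs
    · exact mul_nonneg hκ0 (hf0 a m)
    · exact hf0 l m
  have hkeptle : ∀ l m, kept l m ≤ f l m := by
    intro l m; rw [hkept]; split_ifs with hla
    · rw [hla]; nlinarith [hf0 a m]
    · exact le_rfl
  obtain ⟨φ, hφ⟩ : ∃ φ : ℕ → ℕ → ℝ, ∀ l m, φ l m =
      if (1 ≤ l ∧ l ≤ j ∧ 2 * (l : ℝ) < t) ∧ m ≤ j then kept l m + R l * π * w m / W else 0 :=
    ⟨_, fun l m => rfl⟩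
  have hslot0 : ∀ l m, 0 ≤ R l * π * w m / W := fun l m =>
    div_nonneg (mul_nonneg (mul_nonneg (hR0 l) hπ0) (hw0 m)) hW0
  have hφ0 : ∀ l m, 0 ≤ φ l m := by
    intro l m; rw [hφ]; split_ifs
    · exact add_nonneg (hkept0 l m) (hslot0 l m)
    · exact le_rfl
  have hφout : ∀ l m, ¬ ((1 ≤ l ∧ l ≤ j ∧ 2 * (l : ℝ) < t) ∧ m ≤ j) → φ l m = 0 := by
    intro l m hc; rw [hφ, if_neg hc]
  have hφin : ∀ l m, (1 ≤ l ∧ l ≤ j ∧ 2 * (l : ℝ) < t) → m ≤ j → φ l m = kept l m + R l * π * w m / W := by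
    intro l m hc hm; rw [hφ, if_pos ⟨hc, hm⟩]
  -- the charged pairs of `φ`
  have hcompat : ∀ l m, 0 < φ l m →
      (1 ≤ l ∧ l ≤ j ∧ 2 * (l : ℝ) < t) ∧ m ≤ j ∧ τ < (l : ℝ) + m ∧ τ < 2 * (m : ℝ) := by
    intro l m hp
    have hcond : (1 ≤ l ∧ l ≤ j ∧ 2 * (l : ℝ) < t) ∧ m ≤ j := by
      by_contra hc; rw [hφout l m hc] at hp; exact lt_irrefl 0 hp
    refine ⟨hcond.1, hcond.2, ?_⟩
    obtain ⟨⟨hl1, hlj, hl2⟩, hmj⟩ := hcond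
    rw [hφin l m ⟨hl1, hlj, hl2⟩ hmj] at hp
    rcases (hkept0 l m).eq_or_lt with hk | hk
    · -- a slot fill is charged: `l ≥ a` and the slot is a mid pair of `0` or of `a`
      rw [← hk, zero_add] at hp
      have hRl : 0 < R l := by
        by_contra hc
        rw [le_antisymm (not_lt.1 hc) (hR0 l), zero_mul, zero_mul, zero_div] at hp
        exact lt_irrefl 0 hp
      have hla : (a : ℝ) ≤ l := by exact_mod_cast hRge l hl1 hRl
      have hwm : 0 < w m := by
        by_contra hc
        rw [le_antisymm (not_lt.1 hc) (hw0 m), mul_zero, zero_div] at hp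
        exact lt_irrefl 0 hp
      have key : τ < (a : ℝ) + m := by
        rcases (hf0 0 m).eq_or_lt with h0 | h0
        · have ham : 0 < f a m := by
            by_contra hc
            have h1 : f a m = 0 := le_antisymm (not_lt.1 hc) (hf0 a m)
            have : w m = 0 := by rw [hw, ← h0, h1]; ring
            linarith
          exact (hfmid a m hmj ham).1
        · have := (hfmid 0 m hmj h0).1
          push_cast at this
          linarith
      exact ⟨by linarith, by linarith⟩
    · -- a kept pair of `f`
      obtain ⟨h1, h2, _⟩ := hfmid l m hmj (lt_of_lt_of_le hk (hkeptle l m))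
      exact ⟨h1, by linarith⟩
  have hφsupp : ∀ l m, 0 < φ l m → l ≤ j ∧ 2 * (l : ℝ) < t ∧ m ≤ M + a ∧ (j + 1 ≤ m ∨ t < (l : ℝ) + m) := by
    intro l m hp
    obtain ⟨⟨_, hlj, hl2⟩, hmj, hc, _⟩ := hcompat l m hp
    exact ⟨hlj, hl2, by omega, Or.inr (by linarith)⟩
  have hφmid : ∀ l m, 0 < φ l m → 1 ≤ l ∧ m ≤ j ∧ τ < 2 * (m : ℝ) := by
    intro l m hp
    obtain ⟨⟨hl1, _, _⟩, hmj, _, h2⟩ := hcompat l m hp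
    exact ⟨hl1, hmj, h2⟩
  -- COLUMN LOADS (`gateMoveBlob_col`)
  have hcol := gateMoveBlob_col y t τ a j f κ π W Rtot R w kept φ hy0 hy1 htτ ha haj hat hf0 hfmid hκ0 hκ1 hπ0 hW0 hπR
    hR0 hRge hRtot hw hkept hφin hφout
  -- ROWS
  have hrowφ : ∀ l : ℕ, 1 ≤ l → l ≤ j → 2 * (l : ℝ) < t →
      ∑ m ∈ Finset.range (M + a + 1), φ l m = (if l = a then Fm a - vM else Fm l) + R l * π := by
    intro l hl1 hlj hl2
    have hcond : 1 ≤ l ∧ l ≤ j ∧ 2 * (l : ℝ) < t := ⟨hl1, hlj, hl2⟩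
    rw [← Finset.sum_range_add_sum_Ico _ hjN1]
    have hz' : ∑ m ∈ Finset.Ico (j + 1) (M + a + 1), φ l m = 0 :=
      Finset.sum_eq_zero fun m hm => hφout l m (fun h' => by
        have := (Finset.mem_Ico.1 hm).1; omega)
    rw [hz', add_zero]
    have e : ∀ m ∈ Finset.range (j + 1), φ l m = kept l m + R l * π / W * w m := by
      intro m hm
      rw [hφin l m hcond (Nat.lt_succ_iff.1 (Finset.mem_range.1 hm))]; ring
    rw [Finset.sum_congr rfl e, Finset.sum_add_distrib, ← Finset.mul_sum, hwsum]
    have hk : ∑ m ∈ Finset.range (j + 1), kept l m = (if l = a then Fm a - vM else Fm l) := by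
      by_cases hla : l = a
      · have e2 : ∀ m ∈ Finset.range (j + 1), kept l m = κ * f a m := fun m _ => by rw [hkept, if_pos hla]
        rw [if_pos hla, Finset.sum_congr rfl e2, ← Finset.mul_sum, ← hFm, hκF]
      · have e2 : ∀ m ∈ Finset.range (j + 1), kept l m = f l m := fun m _ => by rw [hkept, if_neg hla]
        rw [if_neg hla, Finset.sum_congr rfl e2, ← hFm]
    rw [hk]
    rcases hW0.eq_or_lt with hW0' | hWpos
    · rw [← hW0', div_zero, zero_mul, hRπ l hl1 hlj hl2 hW0'.symm]
    · rw [div_mul_cancel₀ _ (ne_of_gt hWpos)]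
  -- what is left of a nonzero low
  have hPl : ∀ l : ℕ, 1 ≤ l → l ≤ j → 2 * (l : ℝ) < t →
      slice ν a g l + g * z * ((if l = 0 then (1 : ℝ) else 0) - (if l = a then (1 : ℝ) else 0))
        - ∑ m ∈ Finset.range (M + a + 1), φ l m = (1 - π) * R l := by
    intro l hl1 hlj hl2
    have hr := hrow l hlj (by linarith)
    have h0 : (if l = 0 then (1 : ℝ) else 0) = 0 := if_neg (by omega)
    rw [hrowφ l hl1 hlj hl2, h0]
    by_cases hla : l = a
    · have h2 : (if l = a then (1 : ℝ) else 0) = 1 := if_pos hla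
      have h3 : (if l = a then Fm a - vM else Fm l) = Fm a - vM := if_pos hla
      have h4 : R l = Gn a - vG := by rw [hR, if_pos hla]
      rw [h2, h3, h4, hla]
      rw [hla] at hr
      linear_combination -hr - hgzsplit
    · have h2 : (if l = a then (1 : ℝ) else 0) = 0 := if_neg hla
      have h3 : (if l = a then Fm a - vM else Fm l) = Fm l := if_neg hla
      have h4 : R l = Gn l := by rw [hR, if_neg hla]
      rw [h2, h3, h4]
      linear_combination -hr
  refine ⟨φ, hφ0, hφsupp, hφmid, hcol, fun l hl1 hlj hl2 => ?_, ?_⟩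
  · have := hPl l hl1 hlj hl2
    nlinarith [mul_nonneg (sub_nonneg.2 hπ1) (hR0 l)]
  · by_cases hcase : Rtot ≤ W
    · -- slots not full: every nonzero low is fully placed
      left
      intro l hl1 hlj hl2
      have hπ1' : π = 1 := by rw [hπ, if_pos hcase]
      have := hPl l hl1 hlj hl2
      rw [hπ1', sub_self, zero_mul] at this
      linarith
    · -- slots full: the giants have room for the zero atom and the leftovers
      right
      have hπR' : π * Rtot = W := by
        rw [hπ, if_neg hcase, div_mul_cancel₀ _ (ne_of_gt (lt_of_le_of_lt hW0 (not_le.1 hcase)))]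
      have hun : ∑ l ∈ Finset.range (j + 1),
          (if (1 ≤ l ∧ 2 * (l : ℝ) < t) then
            (slice ν a g l + g * z * ((if l = 0 then (1 : ℝ) else 0) - (if l = a then (1 : ℝ) else 0))
              - ∑ m ∈ Finset.range (M + a + 1), φ l m) else 0) = (1 - π) * Rtot := by
        rw [hRtot, Finset.mul_sum]
        refine Finset.sum_congr rfl fun l hl => ?_
        have hlj : l ≤ j := Nat.lt_succ_iff.1 (Finset.mem_range.1 hl)
        by_cases hc : 1 ≤ l ∧ 2 * (l : ℝ) < t
        · rw [if_pos hc, if_pos hc]; exact hPl l hc.1 hlj hc.2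
        · rw [if_neg hc, if_neg hc, mul_zero]
      have hrow0 : Fm 0 + Gn 0 = slice ν a g 0 := hrow 0 (Nat.zero_le j) (by push_cast; linarith)
      have hRtotG : Rtot + vG = ∑ l ∈ Finset.range (j + 1), (if (1 ≤ l ∧ 2 * (l : ℝ) < t) then Gn l else 0) := by
        have e : ∀ l ∈ Finset.range (j + 1), (if (1 ≤ l ∧ 2 * (l : ℝ) < t) then R l else 0)
            = (if (1 ≤ l ∧ 2 * (l : ℝ) < t) then Gn l else 0) - (if l = a then vG else 0) := by
          intro l _
          by_cases hla : l = a
          · have h4 : R l = Gn a - vG := by rw [hR, if_pos hla]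
            have h5 : (if (1 ≤ l ∧ 2 * (l : ℝ) < t) then R l else 0) = R l := if_pos (by rw [hla]; exact ⟨ha, hat⟩)
            have h6 : (if (1 ≤ l ∧ 2 * (l : ℝ) < t) then Gn l else 0) = Gn l := if_pos (by rw [hla]; exact ⟨ha, hat⟩)
            rw [h5, h6, if_pos hla, h4, hla]
          · have h4 : R l = Gn l := by rw [hR, if_neg hla]
            rw [if_neg hla, sub_zero]
            by_cases hc : 1 ≤ l ∧ 2 * (l : ℝ) < t
            · rw [if_pos hc, if_pos hc, h4]
            · rw [if_neg hc, if_neg hc]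
        rw [hRtot, Finset.sum_congr rfl e, Finset.sum_sub_distrib, Finset.sum_ite_eq' (Finset.range (j + 1)) a,
          if_pos (Finset.mem_range.2 (Nat.lt_succ_of_le haj))]
        ring
      have hGsum : slice ν a g 0 + g * z + (1 - π) * Rtot ≤ ∑ l ∈ Finset.range (j + 1), Gn l := by
        have h1 : slice ν a g 0 + g * z + (1 - π) * Rtot = Gn 0 + (Rtot + vG) := by
          rw [← hrow0, hgzsplit]; linear_combination -hπR' - hW
        obtain ⟨E, hE⟩ : ∃ E : ℕ → ℝ, ∀ l, E l = (if l = 0 then Gn l else 0)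
            + (if (1 ≤ l ∧ 2 * (l : ℝ) < t) then Gn l else 0) := ⟨_, fun l => rfl⟩
        have hEle : ∀ l, E l ≤ Gn l := by
          intro l
          by_cases h0 : l = 0
          · have hc : ¬ (1 ≤ l ∧ 2 * (l : ℝ) < t) := fun hc => by obtain ⟨h1', -⟩ := hc; omega
            have : E l = Gn l := by rw [hE, if_pos h0, if_neg hc, add_zero]
            exact this.le
          · by_cases hc : 1 ≤ l ∧ 2 * (l : ℝ) < t
            · have : E l = Gn l := by rw [hE, if_neg h0, if_pos hc, zero_add]
              exact this.le
            · have : E l = 0 := by rw [hE, if_neg h0, if_neg hc, add_zero]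
              exact this.le.trans (hGn0 l)
        have h2 : Gn 0 + ∑ l ∈ Finset.range (j + 1), (if (1 ≤ l ∧ 2 * (l : ℝ) < t) then Gn l else 0)
            = ∑ l ∈ Finset.range (j + 1), E l := by
          rw [Finset.sum_congr rfl fun l _ => hE l, Finset.sum_add_distrib,
            Finset.sum_ite_eq' (Finset.range (j + 1)) 0, if_pos (Finset.mem_range.2 (Nat.succ_pos j))]
        calc slice ν a g 0 + g * z + (1 - π) * Rtot = Gn 0 + (Rtot + vG) := h1
          _ = Gn 0 + ∑ l ∈ Finset.range (j + 1), (if (1 ≤ l ∧ 2 * (l : ℝ) < t) then Gn l else 0) := by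
              rw [hRtotG]
          _ = ∑ l ∈ Finset.range (j + 1), E l := h2
          _ ≤ ∑ l ∈ Finset.range (j + 1), Gn l := Finset.sum_le_sum fun l _ => hEle l
      have hGcap : y / (1 - y) * ∑ l ∈ Finset.range (j + 1), Gn l
          ≤ ∑ h ∈ Finset.Ico (j + 1) (M + a + 1), slice ν a g h := by
        rw [Finset.mul_sum]
        have e : ∀ l ∈ Finset.range (j + 1), y / (1 - y) * Gn l
            = ∑ h ∈ Finset.Ico (j + 1) (M + a + 1), usage y τ j l h * f l h := by
          intro l _
          rw [hGn, Finset.mul_sum]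
          refine Finset.sum_congr rfl fun h hh => ?_
          rw [usage_giant_eq y τ j l h (Finset.mem_Ico.1 hh).1]
        rw [Finset.sum_congr rfl e, Finset.sum_comm]
        refine Finset.sum_le_sum fun h hh => ?_
        rw [Finset.mem_Ico] at hh
        exact hfcap h (by omega) (Or.inl hh.1)
      have hmain : ∀ U : ℝ, U = (1 - π) * Rtot →
          y / (1 - y) * ((slice ν a g 0 + g * z) + U) ≤ ∑ h ∈ Finset.Ico (j + 1) (M + a + 1), slice ν a g h := by
        intro U hU
        have hy' : 0 ≤ y / (1 - y) := div_nonneg hy0.le (by linarith)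
        have h3 : (slice ν a g 0 + g * z) + U ≤ ∑ l ∈ Finset.range (j + 1), Gn l := by rw [hU]; linarith [hGsum]
        exact (mul_le_mul_of_nonneg_left h3 hy').trans hGcap
      exact hmain _ hun

end LawDec

end Quant

end Summit.CriticalPhenomena.PercolationContinuityZ3.Theorems
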